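import Literature.Probability.RandomPlanarGeometry.LoewnerDriverUniformStability
import Literature.Probability.RandomPlanarGeometry.LoewnerInverseContinuity
import Literature.Probability.RandomPlanarGeometry.SLETraceEight
import Literature.Probability.RandomPlanarGeometry.RestrictionDensityLoewner
import Mathlib.Topology.UniformSpace.CompactConvergence
import HarnessLib

/-!
# Loewner–Carathéodory convergence kit, I: Loewner maps and inverse maps under driver convergence

Crux `Summit.CriticalPhenomena.CardyFormulaZ2.Theses.CardyUniqueLimit.CardyRigidity`
(stmt-CriticalPhenomena-0746), line `crossing_martingale`, helper kit for the registered stub A3b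
`stub_slitObservableApprox` (the percolation heart).  The assembly of A3b compares, along a
subsequence of the Kemppainen–Smirnov box on which the pairs `(γ̂_k, W_k)` converge locally
uniformly, the `k`-th slit half-plane `ℍ ∖ K^{W_k}_{t_k}` (`t_k` the capacity time of an explored
prefix, `t_k → t`) with the limit one THROUGH THE LOEWNER MAPS.  This file exposes, in the exact
vocabulary of the tree (`Loewner.map W t = g_t`, `Loewner.loewnerInv W t = f_t = g_t⁻¹`,
`Loewner.swallowingTime W z = T_z`), the deterministic convergence facts this needs, as thin
wrappers of the tree's Grönwall estimates:

* (L1, inverse maps) `tendstoUniformlyOn_loewnerInv_of_tendstoUniformlyOn_driving` — if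
  `W_n → W` uniformly on `[0, b]` along ANY filter, then `f^{W_n}_t(z) → f^{W}_t(z)` uniformly in
  `(t, z) ∈ [0, b] × {im z ≥ y}` for every `y > 0` (Lawler–Schramm–Werner 2004, Lemma 3.14, from
  the tree's `Loewner.norm_loewnerInv_sub_loewnerInv_le_of_driving`); the time modulus
  `norm_loewnerInv_sub_loewnerInv_le_of_le` (uniform on `{im ≥ y}`), and the JOINT form on path
  space `tendstoUniformlyOn_loewnerInv_nhds`: `(t, w) ↦ f^{w}_t` is continuous from
  `ℝ≥0 × C([0,∞), ℝ)` to the maps `ℍ → ℂ` with the topology of uniform convergence on each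
  `{im ≥ y}` — so `f^{W_k}_{t_k} → f^{W}_t` uniformly on `{im ≥ y}` whenever `(t_k, W_k) → (t, W)`.
* (L1/L3, forward maps) `tendstoUniformlyOn_map_nhds` — for a compact set `K` of points alive at
  time `t₀` under `w₀` (`t₀ < T_z(w₀)`, REAL POINTS AND THEIR COMPLEX NEIGHBOURHOODS INCLUDED: the
  alive set `{z | t₀ < T_z}` is open in `ℂ` and `g_t` is holomorphic on it by the conjugation
  symmetry of the flow — the tree's `Loewner.isOpen_setOf_lt_swallowingTime`,
  `Loewner.differentiableOn_map_of_lt_swallowingTime`, i.e. Schwarz reflection is built in),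
  `g^{w}_t → g^{w₀}_{t₀}` uniformly on `K` as `(t, w) → (t₀, w₀)`, and `K` stays alive
  (Kemppainen–Smirnov 2017, Lemma 5.4 = the tree's
  `Loewner.tendstoUniformlyOn_map_of_tendstoUniformlyOn_driving`, plus joint continuity of
  `(s, z) ↦ g_s(z)`, `Loewner.continuousOn_map_prod`); `exists_closedBall_subset_alive` supplies the
  complex neighbourhood of an alive (e.g. real, unswallowed) point.

References: Lawler (2005) §4.1, §4.7 (Prop. 4.47); Lawler–Schramm–Werner (2004) Lemma 3.14;
Kemppainen–Smirnov (2017) App. A, Lemma 5.4; Pommerenke (1992) §1.4.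
-/

noncomputable section

open Set Filter Topology Metric
open scoped NNReal
open Literature.Probability.RandomPlanarGeometry Literature.Probability.RandomPlanarGeometry.Loewner

namespace Summit.CriticalPhenomena.CardyFormulaZ2.Cruxes.CardyRigidity.CrossingMartingale

namespace LoewnerKit

/-! ### Elementary helpers -/

/-- A time strictly between `t` and a later extended time `T`. [folklore] -/
theorem exists_coe_btwn {t : ℝ≥0} {T : WithTop ℝ≥0} (h : (t : WithTop ℝ≥0) < T) :
    ∃ b : ℝ≥0, t < b ∧ (b : WithTop ℝ≥0) < T := by
  induction T with
  | top => exact ⟨t + 1, lt_add_one t, WithTop.coe_lt_top _⟩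
  | coe c =>
    obtain ⟨b, hb1, hb2⟩ := exists_between (WithTop.coe_lt_coe.1 h)
    exact ⟨b, hb1, WithTop.coe_lt_coe.2 hb2⟩

/-- Paths near `w₀` in `C([0,∞), ℝ)` are uniformly close to `w₀` on `[0, b]`: the evaluation
family converges uniformly on `Iic b` along `𝓝 w₀` (compact-open topology). [folklore] -/
theorem tendstoUniformlyOn_eval_nhds (w₀ : C(ℝ≥0, ℝ)) (b : ℝ≥0) :
    TendstoUniformlyOn (fun (w : C(ℝ≥0, ℝ)) (s : ℝ≥0) ↦ w s) w₀ (𝓝 w₀) (Iic b) := by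
  have h := (ContinuousMap.tendsto_iff_forall_isCompact_tendstoUniformlyOn.1
    (tendsto_id (x := 𝓝 w₀))) (Icc 0 b) isCompact_Icc
  exact h.mono fun s hs ↦ ⟨zero_le, hs⟩

/-- The same along the second coordinate of `ℝ≥0 × C([0,∞), ℝ)`. [folklore] -/
theorem tendstoUniformlyOn_eval_nhds_prod (q₀ : ℝ≥0 × C(ℝ≥0, ℝ)) (b : ℝ≥0) :
    TendstoUniformlyOn (fun (q : ℝ≥0 × C(ℝ≥0, ℝ)) (s : ℝ≥0) ↦ q.2 s) q₀.2 (𝓝 q₀) (Iic b) := by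
  have h := tendstoUniformlyOn_eval_nhds q₀.2 b
  rw [Metric.tendstoUniformlyOn_iff] at h ⊢
  intro ε hε
  exact (continuous_snd.tendsto q₀).eventually (h ε hε)

/-! ### (L1) The inverse Loewner maps under driver convergence (LSW04 Lemma 3.14) -/

section Inverse

variable {ι : Type*} {l : Filter ι} {Wn : ι → ℝ≥0 → ℝ} {W : ℝ≥0 → ℝ} {b : ℝ≥0}

/-- **(L1) Driver convergence ⟹ convergence of the inverse Loewner maps, uniformly on
`[0, b] × {im ≥ y}`.**  If `W_n → W` uniformly on `[0, b]` along a filter (all continuous), then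
`f^{W_n}_t(z) → f^{W}_t(z)` uniformly in `t ≤ b` and `im z ≥ y > 0`
(`|f^U_t(z) - f^V_t(z)| ≤ e^{8t/y²} sup_{[0,t]} |U - V|`, the tree's
`Loewner.norm_loewnerInv_sub_loewnerInv_le_of_driving`).
[cite: LawlerSchrammWerner2004, Lemma 3.14] [cite: Lawler2005, §4.7 Prop. 4.47] -/
theorem tendstoUniformlyOn_loewnerInv_of_tendstoUniformlyOn_driving (hW : Continuous W)
    (hWn : ∀ᶠ n in l, Continuous (Wn n))
    (hconv : TendstoUniformlyOn (fun n (s : ℝ≥0) ↦ Wn n s) W l (Iic b)) {y : ℝ} (hy : 0 < y) :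
    TendstoUniformlyOn (fun n (p : ℝ≥0 × ℂ) ↦ loewnerInv (Wn n) p.1 p.2)
      (fun p ↦ loewnerInv W p.1 p.2) l (Iic b ×ˢ {z : ℂ | y ≤ z.im}) := by
  rw [Metric.tendstoUniformlyOn_iff]
  intro ε hε
  set C : ℝ := Real.exp (8 / y ^ 2 * b) with hC
  have hCpos : 0 < C := Real.exp_pos _
  have hη : 0 < ε / (2 * C) := by positivity
  filter_upwards [hWn, (Metric.tendstoUniformlyOn_iff.1 hconv) _ hη] with n hn hn'
  rintro ⟨t, z⟩ ⟨ht, hz⟩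
  have ht' : (t : ℝ) ≤ b := NNReal.coe_le_coe.2 ht
  have hUV : ∀ u : ℝ≥0, u ≤ t → |W u - Wn n u| ≤ ε / (2 * C) := fun u hu ↦ by
    have := hn' u (hu.trans ht)
    rw [Real.dist_eq] at this
    exact this.le
  have hest := norm_loewnerInv_sub_loewnerInv_le_of_driving hW hn t hy hz hUV
  rw [dist_eq_norm]
  calc ‖loewnerInv W t z - loewnerInv (Wn n) t z‖
      ≤ Real.exp (8 / y ^ 2 * t) * (ε / (2 * C)) := hest
    _ ≤ C * (ε / (2 * C)) := by
        gcongr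
        rw [hC]
        exact Real.exp_le_exp.2 (by gcongr)
    _ = ε / 2 := by field_simp
    _ < ε := by linarith

/-- The same at a fixed time `t ≤ b`: `f^{W_n}_t → f^{W}_t` uniformly on `{im ≥ y}`.
[cite: LawlerSchrammWerner2004, Lemma 3.14] -/
theorem tendstoUniformlyOn_loewnerInv_of_tendstoUniformlyOn_driving_of_le (hW : Continuous W)
    (hWn : ∀ᶠ n in l, Continuous (Wn n))
    (hconv : TendstoUniformlyOn (fun n (s : ℝ≥0) ↦ Wn n s) W l (Iic b)) {y : ℝ} (hy : 0 < y)
    {t : ℝ≥0} (ht : t ≤ b) :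
    TendstoUniformlyOn (fun n z ↦ loewnerInv (Wn n) t z) (loewnerInv W t) l {z : ℂ | y ≤ z.im} := by
  have h := tendstoUniformlyOn_loewnerInv_of_tendstoUniformlyOn_driving hW hWn hconv hy
  rw [Metric.tendstoUniformlyOn_iff] at h ⊢
  intro ε hε
  filter_upwards [h ε hε] with n hn
  exact fun z hz ↦ hn (t, z) ⟨ht, hz⟩

/-- **Time modulus of the inverse maps, uniform on `{im ≥ y}`**: for `s, t ≤ b`, `im z ≥ y > 0`
and `2|t - s|/y ≤ y/2`, `|f_t(z) - f_s(z)| ≤ 8 (1 + 2b/y²) · (2|t - s|/y)` (the tree's two-time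
bound `Loewner.norm_loewnerInv_add_sub_le`, from the inverse cocycle).
[cite: Lawler2005, Lemma 4.33] -/
theorem norm_loewnerInv_sub_loewnerInv_le_of_le (hW : Continuous W) {y : ℝ} (hy : 0 < y) {z : ℂ}
    (hz : y ≤ z.im) {s t : ℝ≥0} (hs : s ≤ b) (ht : t ≤ b)
    (hst : 2 * |(t : ℝ) - s| / y ≤ y / 2) :
    ‖loewnerInv W t z - loewnerInv W s z‖ ≤ 8 * (1 + 2 * b / y ^ 2) * (2 * |(t : ℝ) - s| / y) := by
  have hzpos : 0 < z.im := hy.trans_le hz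
  -- reduce to `s ≤ t` by symmetry
  wlog hle : s ≤ t generalizing s t
  · have h := this ht hs (by rwa [abs_sub_comm]) (le_of_not_ge hle)
    rwa [norm_sub_rev, abs_sub_comm] at h
  obtain ⟨r, rfl⟩ : ∃ r : ℝ≥0, t = s + r := ⟨t - s, (add_tsub_cancel_of_le hle).symm⟩
  have hr : ((s + r : ℝ≥0) : ℝ) - s = r := by push_cast; ring
  rw [hr, abs_of_nonneg r.coe_nonneg] at hst ⊢
  -- the two-time bound at `z`, with `2r/im z ≤ 2r/y ≤ y/2 ≤ im z/2`
  have h1 : 2 * (r : ℝ) / z.im ≤ 2 * r / y := by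
    gcongr
  have h2 : 2 * (r : ℝ) / z.im ≤ z.im / 2 := h1.trans (hst.trans (by linarith))
  have h := norm_loewnerInv_add_sub_le hW s r hzpos h2
  refine h.trans ?_
  have h3 : (z.im + 2 * (s : ℝ) / z.im) / z.im ≤ 1 + 2 * b / y ^ 2 := by
    rw [add_div, div_self hzpos.ne', div_div, ← sq]
    gcongr 1 + ?_
    calc 2 * (s : ℝ) / z.im ^ 2 ≤ 2 * b / z.im ^ 2 := by gcongr
      _ ≤ 2 * b / y ^ 2 := by gcongr
  calc 8 * ((z.im + 2 * (s : ℝ) / z.im) / z.im) * (2 * r / z.im)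
      ≤ 8 * (1 + 2 * b / y ^ 2) * (2 * r / y) := by gcongr
    _ = _ := rfl

/-- **(L1, joint form on path space) `(t, w) ↦ f^{w}_t` is continuous into the maps `ℍ → ℂ`
uniformly on every `{im ≥ y}`**: for `q₀ = (t₀, w₀) ∈ ℝ≥0 × C([0,∞), ℝ)` and `y > 0`,
`f^{w}_t(z) → f^{w₀}_{t₀}(z)` uniformly in `im z ≥ y` as `(t, w) → (t₀, w₀)` (locally uniform
convergence of the driving paths).  In particular `f^{W_k}_{t_k} → f^{W}_{t}` uniformly on
`{im ≥ y}` whenever `W_k → W` locally uniformly and `t_k → t`.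
[cite: LawlerSchrammWerner2004, Lemma 3.14] [cite: Lawler2005, §4.7 Prop. 4.47] -/
theorem tendstoUniformlyOn_loewnerInv_nhds (q₀ : ℝ≥0 × C(ℝ≥0, ℝ)) {y : ℝ} (hy : 0 < y) :
    TendstoUniformlyOn (fun (q : ℝ≥0 × C(ℝ≥0, ℝ)) (z : ℂ) ↦ loewnerInv q.2 q.1 z)
      (fun z ↦ loewnerInv q₀.2 q₀.1 z) (𝓝 q₀) {z : ℂ | y ≤ z.im} := by
  obtain ⟨t₀, w₀⟩ := q₀
  rw [Metric.tendstoUniformlyOn_iff]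
  intro ε hε
  set b : ℝ≥0 := t₀ + 1 with hb
  have ht₀b : t₀ < b := by rw [hb]; exact lt_add_one t₀
  -- driver part: uniformly in `t ≤ b`
  have hdrv := tendstoUniformlyOn_loewnerInv_of_tendstoUniformlyOn_driving (l := 𝓝 (t₀, w₀))
    (Wn := fun q : ℝ≥0 × C(ℝ≥0, ℝ) ↦ (q.2 : ℝ≥0 → ℝ)) w₀.continuous
    (Eventually.of_forall fun q ↦ q.2.continuous) (tendstoUniformlyOn_eval_nhds_prod (t₀, w₀) b) hy
  have h1 := (Metric.tendstoUniformlyOn_iff.1 hdrv) (ε / 2) (half_pos hε)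
  -- time part: `|t - t₀|` small
  set L : ℝ := 8 * (1 + 2 * b / y ^ 2) with hL
  have hLpos : 0 < L := by positivity
  obtain ⟨δ, hδ, hδy, hδε⟩ : ∃ δ : ℝ, 0 < δ ∧ 2 * δ / y ≤ y / 2 ∧ L * (2 * δ / y) < ε / 2 := by
    refine ⟨min (y ^ 2 / 4) (ε * y / (8 * L)), lt_min (by positivity) (by positivity), ?_, ?_⟩
    · have : min (y ^ 2 / 4) (ε * y / (8 * L)) ≤ y ^ 2 / 4 := min_le_left _ _
      rw [div_le_iff₀ hy]
      nlinarith
    · have hm : min (y ^ 2 / 4) (ε * y / (8 * L)) ≤ ε * y / (8 * L) := min_le_right _ _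
      have : L * (2 * min (y ^ 2 / 4) (ε * y / (8 * L)) / y) ≤ L * (2 * (ε * y / (8 * L)) / y) := by
        gcongr
      have h' : L * (2 * (ε * y / (8 * L)) / y) = ε / 4 := by field_simp; ring
      linarith
  have h2 : ∀ᶠ q : ℝ≥0 × C(ℝ≥0, ℝ) in 𝓝 (t₀, w₀), dist q.1 t₀ < δ ∧ q.1 < b := by
    have ha : ∀ᶠ q : ℝ≥0 × C(ℝ≥0, ℝ) in 𝓝 (t₀, w₀), dist q.1 t₀ < δ :=
      (continuous_fst.tendsto (t₀, w₀)).eventually (ball_mem_nhds t₀ hδ)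
    have hb' : ∀ᶠ q : ℝ≥0 × C(ℝ≥0, ℝ) in 𝓝 (t₀, w₀), q.1 < b :=
      (continuous_fst.tendsto (t₀, w₀)).eventually (Iio_mem_nhds ht₀b)
    exact ha.and hb'
  filter_upwards [h1, h2] with q hq hq'
  intro z hz
  obtain ⟨hqt, hqb⟩ := hq'
  have hA : dist (loewnerInv w₀ q.1 z) (loewnerInv q.2 q.1 z) < ε / 2 := hq (q.1, z) ⟨hqb.le, hz⟩
  have hB : ‖loewnerInv w₀ q.1 z - loewnerInv w₀ t₀ z‖ < ε / 2 := by
    have hqt' : |(q.1 : ℝ) - t₀| < δ := by rwa [← Real.dist_eq]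
    have hst : 2 * |(q.1 : ℝ) - t₀| / y ≤ y / 2 :=
      le_trans (by gcongr) hδy
    refine (norm_loewnerInv_sub_loewnerInv_le_of_le w₀.continuous hy hz ht₀b.le hqb.le hst).trans_lt ?_
    calc 8 * (1 + 2 * (b : ℝ) / y ^ 2) * (2 * |(q.1 : ℝ) - t₀| / y)
        ≤ L * (2 * δ / y) := by rw [hL]; gcongr
      _ < ε / 2 := hδε
  calc dist (loewnerInv w₀ t₀ z) (loewnerInv q.2 q.1 z)
      ≤ dist (loewnerInv w₀ t₀ z) (loewnerInv w₀ q.1 z) + dist (loewnerInv w₀ q.1 z) (loewnerInv q.2 q.1 z) :=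
        dist_triangle _ _ _
    _ < ε / 2 + ε / 2 := by
        gcongr
        rwa [dist_comm, dist_eq_norm]
    _ = ε := add_halves ε

end Inverse

/-! ### (L1/L3) The Loewner maps on compact alive sets: real points and complex neighbourhoods -/

section Forward

variable {W : ℝ≥0 → ℝ}

/-- **A compact set of points alive at time `t₀` is alive up to a later time**: if
`t₀ < T_z` for every `z` in the compact `K`, there is `b > t₀` with `b < T_z` on `K` (the alive
sets `{z | b < T_z}` are open and decrease in `b`; directed open cover). [folklore] -/
theorem exists_gt_forall_lt_swallowingTime (hW : Continuous W) {t₀ : ℝ≥0} {K : Set ℂ}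
    (hK : IsCompact K) (hKt : ∀ z ∈ K, (t₀ : WithTop ℝ≥0) < swallowingTime W z) :
    ∃ b : ℝ≥0, t₀ < b ∧ ∀ z ∈ K, (b : WithTop ℝ≥0) < swallowingTime W z := by
  haveI : Nonempty (Ioi t₀) := ⟨⟨t₀ + 1, lt_add_one t₀⟩⟩
  set U : Ioi t₀ → Set ℂ := fun b ↦ {z : ℂ | ((b : ℝ≥0) : WithTop ℝ≥0) < swallowingTime W z}
  have hUo : ∀ b, IsOpen (U b) := fun b ↦ isOpen_setOf_lt_swallowingTime hW _
  have hcover : K ⊆ ⋃ b, U b := by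
    intro z hz
    obtain ⟨b, hb, hbT⟩ := exists_coe_btwn (hKt z hz)
    exact mem_iUnion.2 ⟨⟨b, hb⟩, hbT⟩
  have hdir : Directed (· ⊆ ·) U := by
    rintro ⟨b₁, hb₁⟩ ⟨b₂, hb₂⟩
    refine ⟨⟨min b₁ b₂, show t₀ < min b₁ b₂ from lt_min hb₁ hb₂⟩, fun z (hz : ((b₁ : ℝ≥0) : WithTop ℝ≥0) < _) ↦ ?_,
      fun z (hz : ((b₂ : ℝ≥0) : WithTop ℝ≥0) < _) ↦ ?_⟩
    · exact lt_of_le_of_lt (WithTop.coe_le_coe.2 (min_le_left _ _)) hz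
    · exact lt_of_le_of_lt (WithTop.coe_le_coe.2 (min_le_right _ _)) hz
  obtain ⟨⟨b, hb⟩, hKb⟩ := hK.elim_directed_cover U hUo hcover hdir
  exact ⟨b, hb, fun z hz ↦ hKb hz⟩

/-- **Complex neighbourhoods of alive points**: if `z₀` (e.g. a real point off the closure of
the swallowed set) is alive at time `t`, a closed disc about `z₀` is alive at time `t`
(`Loewner.isOpen_setOf_lt_swallowingTime`: the two-sided alive set is open in `ℂ`).
[cite: Lawler2005, Ch. 4 §4.1] -/
theorem exists_closedBall_subset_alive (hW : Continuous W) {t : ℝ≥0} {z₀ : ℂ}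
    (hz₀ : (t : WithTop ℝ≥0) < swallowingTime W z₀) :
    ∃ r > (0 : ℝ), ∀ z ∈ closedBall z₀ r, (t : WithTop ℝ≥0) < swallowingTime W z := by
  obtain ⟨r, hr, hsub⟩ := Metric.isOpen_iff.1 (isOpen_setOf_lt_swallowingTime hW t) z₀ hz₀
  exact ⟨r / 2, half_pos hr, fun z hz ↦ hsub (closedBall_subset_ball (half_lt_self hr) hz)⟩

/-- **The Loewner map is holomorphic on a complex neighbourhood of an alive point** (in
particular across the real axis at an unswallowed real point: Schwarz reflection is built into
the two-sided flow, `Loewner.differentiableOn_map_of_lt_swallowingTime`).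
[cite: Lawler2005, Ch. 4 §4.1] -/
theorem differentiableOn_map_of_forall_lt_swallowingTime (hW : Continuous W) {t : ℝ≥0} {S : Set ℂ}
    (hS : ∀ z ∈ S, (t : WithTop ℝ≥0) < swallowingTime W z) : DifferentiableOn ℂ (map W t) S :=
  (differentiableOn_map_of_lt_swallowingTime hW t).mono hS

/-- **(L1/L3, joint form on path space) The Loewner maps converge uniformly on compact alive
sets, jointly in time and driving path.**  Let `K` be a compact set of points alive at time `t₀`
under the driving path `w₀` (`t₀ < T_z(w₀)` for `z ∈ K`; real points and their complex
neighbourhoods allowed).  Then, as `(t, w) → (t₀, w₀)` in `ℝ≥0 × C([0,∞), ℝ)`, every point of `K`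
stays alive at time `t` under `w` and `g^{w}_t → g^{w₀}_{t₀}` uniformly on `K`
(Kemppainen–Smirnov's Lemma 5.4, `Loewner.tendstoUniformlyOn_map_of_tendstoUniformlyOn_driving`,
up to a time `b > t₀` alive on `K`, and uniform continuity of `(s, z) ↦ g^{w₀}_s(z)` on
`[0, b] × K`, `Loewner.continuousOn_map_prod`).
[cite: KemppainenSmirnov2017, App. A, Lemma 5.4] [cite: Lawler2005, §4.7 Prop. 4.47] -/
theorem tendstoUniformlyOn_map_nhds (q₀ : ℝ≥0 × C(ℝ≥0, ℝ)) {K : Set ℂ} (hK : IsCompact K)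
    (hKt : ∀ z ∈ K, (q₀.1 : WithTop ℝ≥0) < swallowingTime q₀.2 z) :
    (∀ᶠ q : ℝ≥0 × C(ℝ≥0, ℝ) in 𝓝 q₀, ∀ z ∈ K, (q.1 : WithTop ℝ≥0) < swallowingTime q.2 z) ∧
    TendstoUniformlyOn (fun (q : ℝ≥0 × C(ℝ≥0, ℝ)) (z : ℂ) ↦ map q.2 q.1 z)
      (fun z ↦ map q₀.2 q₀.1 z) (𝓝 q₀) K := by
  obtain ⟨t₀, w₀⟩ := q₀
  simp only at hKt ⊢
  obtain ⟨b, ht₀b, hKb⟩ := exists_gt_forall_lt_swallowingTime w₀.continuous hK hKt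
  have hcont : ∀ᶠ q : ℝ≥0 × C(ℝ≥0, ℝ) in 𝓝 (t₀, w₀), Continuous ((q.2 : ℝ≥0 → ℝ)) :=
    Eventually.of_forall fun q ↦ q.2.continuous
  have hconv := tendstoUniformlyOn_eval_nhds_prod (t₀, w₀) b
  have htime : ∀ᶠ q : ℝ≥0 × C(ℝ≥0, ℝ) in 𝓝 (t₀, w₀), q.1 < b :=
    (continuous_fst.tendsto (t₀, w₀)).eventually (Iio_mem_nhds ht₀b)
  have halive := eventually_forall_lt_swallowingTime_of_tendstoUniformlyOn_driving
    (Wn := fun q : ℝ≥0 × C(ℝ≥0, ℝ) ↦ (q.2 : ℝ≥0 → ℝ)) w₀.continuous hcont hconv hK hKb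
  refine ⟨?_, ?_⟩
  · filter_upwards [halive, htime] with q hq hqt
    exact fun z hz ↦ lt_trans (WithTop.coe_lt_coe.2 hqt) (hq z hz)
  -- uniform convergence on `[0, b] × K`, then move the time
  have hmaps := tendstoUniformlyOn_map_of_tendstoUniformlyOn_driving
    (Wn := fun q : ℝ≥0 × C(ℝ≥0, ℝ) ↦ (q.2 : ℝ≥0 → ℝ)) w₀.continuous hcont hconv hK hKb
  rw [Metric.tendstoUniformlyOn_iff] at hmaps ⊢
  intro ε hε
  -- uniform continuity of `(s, z) ↦ g_s(z)` on the compact `[0, b] × K`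
  have hKc : IsCompact (Icc 0 b ×ˢ K) := isCompact_Icc.prod hK
  have hcts : ContinuousOn (fun p : ℝ≥0 × ℂ ↦ map w₀ p.1 p.2) (Icc 0 b ×ˢ K) :=
    (continuousOn_map_prod w₀.continuous).mono (prod_mono (fun s hs ↦ hs.2) hKb)
  have huc := hKc.uniformContinuousOn_of_continuous hcts
  obtain ⟨δ, hδ, hδε⟩ := Metric.uniformContinuousOn_iff.1 huc (ε / 2) (half_pos hε)
  have htime' : ∀ᶠ q : ℝ≥0 × C(ℝ≥0, ℝ) in 𝓝 (t₀, w₀), dist q.1 t₀ < δ :=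
    (continuous_fst.tendsto (t₀, w₀)).eventually (ball_mem_nhds t₀ hδ)
  filter_upwards [hmaps (ε / 2) (half_pos hε), htime, htime'] with q hq hqt hqδ
  intro z hz
  have hA : dist (map w₀ q.1 z) (map q.2 q.1 z) < ε / 2 := hq (q.1, z) ⟨hqt.le, hz⟩
  have hB : dist (map w₀ t₀ z) (map w₀ q.1 z) < ε / 2 := by
    have h := hδε (t₀, z) ⟨⟨zero_le, ht₀b.le⟩, hz⟩ (q.1, z) ⟨⟨zero_le, hqt.le⟩, hz⟩ (by
      rw [Prod.dist_eq, dist_self, max_eq_left dist_nonneg, dist_comm]; exact hqδ)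
    exact h
  calc dist (map w₀ t₀ z) (map q.2 q.1 z)
      ≤ dist (map w₀ t₀ z) (map w₀ q.1 z) + dist (map w₀ q.1 z) (map q.2 q.1 z) :=
        dist_triangle _ _ _
    _ < ε / 2 + ε / 2 := add_lt_add hB hA
    _ = ε := add_halves ε

/-- **(L3) Convergence on a complex neighbourhood of an alive point.**  If `z₀` is alive at time
`t₀` under `w₀` (e.g. `z₀ = x` real, off the closure of the set swallowed by time `t₀`), there is
`r > 0` such that, as `(t, w) → (t₀, w₀)`, the closed disc `closedBall z₀ r` stays alive at time
`t` under `w` and `g^{w}_t → g^{w₀}_{t₀}` uniformly on it; all these maps are holomorphic there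
(`differentiableOn_map_of_forall_lt_swallowingTime`). [cite: KemppainenSmirnov2017, App. A, Lemma 5.4]
[cite: Lawler2005, Ch. 4 §4.1] -/
theorem exists_closedBall_tendstoUniformlyOn_map_nhds (q₀ : ℝ≥0 × C(ℝ≥0, ℝ)) {z₀ : ℂ}
    (hz₀ : (q₀.1 : WithTop ℝ≥0) < swallowingTime q₀.2 z₀) :
    ∃ r > (0 : ℝ), (∀ z ∈ closedBall z₀ r, (q₀.1 : WithTop ℝ≥0) < swallowingTime q₀.2 z) ∧
      (∀ᶠ q : ℝ≥0 × C(ℝ≥0, ℝ) in 𝓝 q₀, ∀ z ∈ closedBall z₀ r,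
        (q.1 : WithTop ℝ≥0) < swallowingTime q.2 z) ∧
      TendstoUniformlyOn (fun (q : ℝ≥0 × C(ℝ≥0, ℝ)) (z : ℂ) ↦ map q.2 q.1 z)
        (fun z ↦ map q₀.2 q₀.1 z) (𝓝 q₀) (closedBall z₀ r) := by
  obtain ⟨r, hr, hball⟩ := exists_closedBall_subset_alive q₀.2.continuous hz₀
  exact ⟨r, hr, hball, tendstoUniformlyOn_map_nhds q₀ (isCompact_closedBall z₀ r) hball⟩

end Forward

end LoewnerKit

/-- **Registered form** (anchor `loewnerKit_tendstoUniformlyOn_loewnerInv_nhds` of stmt-CriticalPhenomena-0746): the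
inverse Loewner maps `f^{w}_t` depend continuously on `(t, w) ∈ ℝ≥0 × C([0,∞), ℝ)`, uniformly on every `{im ≥ y}`,
`y > 0` (LSW04 Lemma 3.14 in joint form). [cite: LawlerSchrammWerner2004, Lemma 3.14] -/
theorem loewnerKit_tendstoUniformlyOn_loewnerInv_nhds : ∀ (q₀ : NNReal × ContinuousMap NNReal ℝ) (y : ℝ), 0 < y → TendstoUniformlyOn (fun (q : NNReal × ContinuousMap NNReal ℝ) (z : ℂ) ↦ Literature.Probability.RandomPlanarGeometry.Loewner.loewnerInv (⇑q.2) q.1 z) (fun z ↦ Literature.Probability.RandomPlanarGeometry.Loewner.loewnerInv (⇑q₀.2) q₀.1 z) (nhds q₀) {z : ℂ | y ≤ z.im} :=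
  fun q₀ _ hy ↦ LoewnerKit.tendstoUniformlyOn_loewnerInv_nhds q₀ hy

end Summit.CriticalPhenomena.CardyFormulaZ2.Cruxes.CardyRigidity.CrossingMartingale

end
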